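import Summits.Ventures.PercRepro.SixFourResidueThreeSmall
import Summits.Ventures.PercRepro.SixFourResidueThreeGeneric
import Summits.Ventures.PercRepro.SixFourResidueThreeOnePointC
import Summits.Ventures.PercRepro.SixFourResidueThreeTwoPointsD
import Summits.Ventures.PercRepro.SixFourResidueThreeSmallG

/-!
# PercRepro — C-025 at `(6,4)`: THE `g ≤ 9` CLAUSE OF `SixFourResidue` AT `t = 3` (p2, gen 9 — §21.18.1 at `t = 3`)

`0 ≤ J₃(G)` for every rank-`4` set `G ⊆ E` of a simple matroid with at most `9` points, by the trichotomy of
§21.18.1: `g ≤ 6` (`J_three_nonneg_of_card_le_six`, demand-free), (α) generic (`J_three_nonneg_of_generic_small`,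
Theorem G₃ with the §21.16 certificate at `g = 7, 8, 9`), (β) a plane trace with `g − 1` or `g − 2` points
(`J_three_nonneg_of_plane_add_one'` = Prop. 21.5 at `t = 3` for `P ≤ 8`, `J_three_nonneg_of_plane_add_two'` =
Theorem 21.6 at `t = 3` for `P ≤ 7` with the refined demand count), (γ) otherwise every plane trace has `≤ g − 3`
points and `G` is plane-line (`J_three_nonneg_of_planeLine_le_ten`, the exact lists of §21.18.9.5 with Lemma X̄₂).
This is the `g ≤ 9` part of the type-`3` clause `typeOf M G = 3 → ¬ Cell10 M G → 0 ≤ J M G 3` of `SixFourResidue`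
(`SixFourTransfer.lean`), stated without `typeOf`; together with mine-2's Theorem 21′ (`g ≥ 10`, paper) it is the
whole type-`3` clause.  `J_three_nonneg_of_card_le_eight` is the `g ≤ 8` special case.
-/

namespace PercRepro.SixFour

open Finset ThmH

variable {α : Type*} [DecidableEq α] {M : Matroid α} [M.Finite] {G : Finset α}

/-- **The `g ≤ 9` clause at `t = 3`**: `0 ≤ J₃(G)` for every rank-`4` set `G ⊆ E` of a simple matroid with
`|G| ≤ 9`. -/
theorem J_three_nonneg_of_card_le_nine (hs : Simple M) (hG : G ⊆ gr M) (hr : M.eRk (G : Set α) = 4)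
    (hg : G.card ≤ 9) : 0 ≤ J M G 3 := by
  by_cases h6 : G.card ≤ 6
  · exact J_three_nonneg_of_card_le_six h6
  push Not at h6
  by_cases hgen : Generic M G
  · exact J_three_nonneg_of_generic_small hs hG hr hgen (by omega) hg
  by_cases hbig : ∃ P ∈ planes M, G.card ≤ (P ∩ G).card + 2
  · obtain ⟨P, hP, hPc⟩ := hbig
    have hlt : (P ∩ G).card < G.card := by
      apply Finset.card_lt_card
      refine ⟨Finset.inter_subset_right, fun h => ?_⟩
      have hsub : G ⊆ P := fun z hz => (Finset.mem_inter.1 (h hz)).1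
      have hle := M.eRk_mono (Finset.coe_subset.2 hsub)
      rw [hr, (mem_planes.1 hP).2.2] at hle
      have h43 : (4 : ℕ) ≤ 3 := by exact_mod_cast hle
      omega
    rcases (show (P ∩ G).card + 1 = G.card ∨ (P ∩ G).card + 2 = G.card by omega) with h1 | h2
    · exact J_three_nonneg_of_plane_add_one' hs hG hP h1 hg
    · exact J_three_nonneg_of_plane_add_two' hs hG hr hP h2 hg
  · push Not at hbig
    exact J_three_nonneg_of_planeLine_le_ten hs hG hr hgen (fun P hP => by have := hbig P hP; omega) (by omega)
      (by omega)

/-- **The `g ≤ 8` clause at `t = 3`** (the special case `g ≤ 8` of `J_three_nonneg_of_card_le_nine`). -/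
theorem J_three_nonneg_of_card_le_eight (hs : Simple M) (hG : G ⊆ gr M) (hr : M.eRk (G : Set α) = 4)
    (hg : G.card ≤ 8) : 0 ≤ J M G 3 :=
  J_three_nonneg_of_card_le_nine hs hG hr (by omega)

end PercRepro.SixFour
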